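import Literature.NumberTheory.LFunctions.PrimitiveQuadraticCharacter
import Mathlib.Algebra.Ring.GeomSum
import HarnessLib

/-!
# The modulus of a primitive quadratic Dirichlet character: `4 ∣ q` or `q` odd squarefree, and
# `q ≡ 3 (mod 4)` for odd characters of odd modulus

Topic `Literature/NumberTheory/LFunctions`. Everything in this file is PROVED (theorems only); it
continues `PrimitiveQuadraticCharacter.lean` (namespace
`Literature.NumberTheory.LFunctions.PrimitiveQuadratic`), which identifies the primitive quadratic
character modulo an odd squarefree `q` with the Jacobi symbol `(·/q)`.

The classical fact that the primitive real characters are exactly the Kronecker symbols `(D/·)`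
of the fundamental discriminants `D`, of conductor `|D|` (Davenport, *Multiplicative Number
Theory*, Ch. 5; Montgomery–Vaughan, Thm. 9.13), contains in particular the following constraints
on the conductor `q` of a primitive quadratic character `χ`, which we prove directly:

* `four_dvd_of_isPrimitive_of_even` — if `q` is even then `4 ∣ q` (indeed for `q = 2m`, `m` odd,
  every character mod `q` factors through `m`, the units `≡ 1 (mod m)` being `≡ 1 (mod 2m)`);
  this holds for every primitive character, quadratic or not;
* `squarefree_of_isPrimitive_of_isQuadratic` — if `q` is odd then `q` is squarefree (if
  `p² ∣ q`, the units `x ≡ 1 (mod q/p)` satisfy `x^p = 1`, so a quadratic `χ` is trivial on them —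
  `χ(x) = −1` would give `(−1)^p = 1` — and `χ` would factor through `q/p`);
* `mod_four_eq_three_of_odd` — if `q` is odd and `χ` is odd (`χ(−1) = −1`) then `q ≡ 3 (mod 4)`
  (by the previous item and `apply_natCast_eq_jacobiSym`, `χ(−1) = (−1/q) = χ₄(q)`); similarly
  `mod_four_eq_one_of_even` for even `χ` and odd `q > 1`;
* `neg_emod_four_of_odd` — hence the modulus `q` of an odd primitive quadratic character has
  `−q ≡ 0` or `1 (mod 4)`: `−q` is a discriminant (in fact the fundamental discriminant of the
  imaginary quadratic field whose Kronecker character is `χ`), so that the reduced forms of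
  discriminant `−q` and their class number `h(−q) ≥ 1`
  (`Literature.NumberTheory.QuadraticFields`, `principalForm_mem_reducedForms`) are available —
  the form in which the modulus enters Granville–Stark's class-number bound
  (`Literature/NumberTheory/DiophantineGeometry/AbcWave0.lean`, abc.S22).

Mathlib has `DirichletCharacter.conductor`, `FactorsThrough`, `factorsThrough_iff_ker_unitsMap`,
the Jacobi symbol with `jacobiSym.at_neg_one`, `ZMod.χ₄_nat_eq_if_mod_four`; no classification of
real primitive characters (searched `IsPrimitive` with `quadratic`/`Squarefree`/`fundamental`:
only the tree's `PrimitiveQuadraticCharacter.lean`).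

## References

* [MontgomeryVaughan2007] H. L. Montgomery, R. C. Vaughan, *Multiplicative Number Theory I*, CUP
  2007, §9.3, Theorem 9.13 (primitive quadratic characters ↔ fundamental discriminants).
* H. Davenport, *Multiplicative Number Theory*, 3rd ed., GTM 74 (2000), Ch. 5.
-/

noncomputable section

open DirichletCharacter Finset

namespace Literature.NumberTheory.LFunctions.PrimitiveQuadratic

/-! ### Even moduli: `4 ∣ q` -/

/-- **A primitive character of even modulus `q` has `4 ∣ q`.** If `q = 2m` with `m` odd, a unit
`x` mod `2m` with `x ≡ 1 (mod m)` is odd, hence `≡ 1 (mod 2m)`; so every character mod `2m` is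
trivial on the kernel of `(ℤ/2m)ˣ → (ℤ/m)ˣ` and factors through `m`
(`DirichletCharacter.factorsThrough_iff_ker_unitsMap`), contradicting primitivity.
[cite: MontgomeryVaughan2007, Theorem 9.13] -/
theorem four_dvd_of_isPrimitive_of_even {q : ℕ} [NeZero q] (heven : Even q)
    {χ : DirichletCharacter ℂ q} (hprim : χ.IsPrimitive) : 4 ∣ q := by
  by_contra h4
  obtain ⟨m, hm⟩ : 2 ∣ q := even_iff_two_dvd.mp heven
  have hmodd : m % 2 = 1 := by
    by_contra hm2
    exact h4 ⟨m / 2, by omega⟩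
  have hm0 : 0 < m := by
    have := NeZero.pos q
    rw [hm] at this
    omega
  subst hm
  have hc2m : Nat.Coprime 2 m := Nat.coprime_two_left.2 (Nat.odd_iff.2 hmodd)
  -- every character mod `2m` factors through `m`
  have hft : χ.FactorsThrough m := by
    rw [factorsThrough_iff_ker_unitsMap (Dvd.intro_left 2 rfl)]
    intro x hx
    rw [MonoidHom.mem_ker, ZMod.unitsMap_def, Units.ext_iff, Units.coe_map, MonoidHom.coe_coe,
      ZMod.castHom_apply, Units.val_one] at hx
    rw [MonoidHom.mem_ker, Units.ext_iff, MulChar.coe_toUnitHom, Units.val_one]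
    suffices hx1 : (x : ZMod (2 * m)) = 1 by rw [hx1, map_one]
    set n : ℕ := (x : ZMod (2 * m)).val with hn
    have hxn : (x : ZMod (2 * m)) = (n : ZMod (2 * m)) := (ZMod.natCast_zmod_val _).symm
    have hcop : n.Coprime (2 * m) := ZMod.val_coe_unit_coprime x
    have hn2 : n ≡ 1 [MOD 2] :=
      Nat.odd_iff.mp (Nat.coprime_two_right.mp (Nat.Coprime.coprime_mul_right_right hcop))
    have hnm : n ≡ 1 [MOD m] := by
      have h := hx
      rw [ZMod.cast_eq_val] at h
      have h' : ((n : ℕ) : ZMod m) = ((1 : ℕ) : ZMod m) := by rw [Nat.cast_one]; exact h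
      exact (ZMod.natCast_eq_natCast_iff _ _ _).mp h'
    have hmod : n ≡ 1 [MOD 2 * m] := (Nat.modEq_and_modEq_iff_modEq_mul hc2m).mp ⟨hn2, hnm⟩
    rw [hxn]
    have := (ZMod.natCast_eq_natCast_iff n 1 (2 * m)).mpr hmod
    rwa [Nat.cast_one] at this
  have hdvd : χ.conductor ∣ m :=
    conductor_dvd_of_mem_conductorSet χ ((mem_conductorSet_iff χ).2 hft)
  rw [hprim] at hdvd
  have := Nat.le_of_dvd hm0 hdvd
  omega

/-! ### Odd moduli: `q` is squarefree -/

/-- **A primitive quadratic character of odd modulus `q` has squarefree `q`.** If `p² ∣ q`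
(`p` an odd prime), write `q = p·m` with `p ∣ m`: a unit `x ≡ 1 (mod m)` has `x^p ≡ 1 (mod pm)`
(`x^p − 1 = (x − 1)(x^{p−1} + ⋯ + 1)` with `m ∣ x − 1` and `p ∣ x^{p−1} + ⋯ + 1` as
`x ≡ 1 (mod p)`), so `χ(x)^p = 1` and `χ(x) ∈ {±1}` force `χ(x) = 1` (`p` odd); thus `χ` is
trivial on the kernel of `(ℤ/pm)ˣ → (ℤ/m)ˣ`, i.e. factors through `m`
(`exists_apply_ne_one_of_isPrimitive`), contradicting primitivity.
[cite: MontgomeryVaughan2007, Theorem 9.13] -/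
theorem squarefree_of_isPrimitive_of_isQuadratic {q : ℕ} [NeZero q] (hodd : Odd q)
    {χ : DirichletCharacter ℂ q} (hprim : χ.IsPrimitive) (hquad : χ.IsQuadratic) :
    Squarefree q := by
  rw [Nat.squarefree_iff_prime_squarefree]
  intro p hp hpp
  -- `p` is odd
  have hp2 : p ≠ 2 := by
    rintro rfl
    have : 2 ∣ q := (dvd_mul_right 2 2).trans hpp
    exact (Nat.not_even_iff_odd.2 hodd) (even_iff_two_dvd.2 this)
  have hpodd : Odd p := hp.odd_of_ne_two hp2
  -- `q = p m` with `p ∣ m`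
  obtain ⟨m, hm⟩ : p ∣ q := (dvd_mul_right p p).trans hpp
  have hpm : p ∣ m := by
    obtain ⟨r, hr⟩ := hpp
    refine ⟨r, Nat.eq_of_mul_eq_mul_left hp.pos ?_⟩
    rw [← hm, hr, mul_assoc]
  subst hm
  haveI : Fact p.Prime := ⟨hp⟩
  obtain ⟨x, hx1, hxne⟩ := exists_apply_ne_one_of_isPrimitive hp hprim
  -- `χ x = -1`
  have hxm1 : χ (x : ZMod (p * m)) = -1 := by
    rcases hquad (x : ZMod (p * m)) with h0 | h1 | h2
    · exact absurd h0 (IsUnit.ne_zero ((Units.isUnit x).map χ))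
    · exact absurd h1 hxne
    · exact h2
  -- `x ≡ 1 (mod m)`, hence `(mod p)`
  set n : ℕ := (x : ZMod (p * m)).val with hn
  have hxn : (x : ZMod (p * m)) = (n : ZMod (p * m)) := (ZMod.natCast_zmod_val _).symm
  have hnm : n ≡ 1 [MOD m] := by
    have h := hx1
    rw [ZMod.cast_eq_val] at h
    have h' : ((n : ℕ) : ZMod m) = ((1 : ℕ) : ZMod m) := by rw [Nat.cast_one]; exact h
    exact (ZMod.natCast_eq_natCast_iff _ _ _).mp h'
  have hnp : n ≡ 1 [MOD p] := Nat.ModEq.of_dvd hpm hnm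
  -- `p m ∣ n^p - 1`
  have hdvd1 : (m : ℤ) ∣ (n : ℤ) - 1 := by
    have := Nat.modEq_iff_dvd.mp hnm.symm
    simpa using this
  have hdvd2 : (p : ℤ) ∣ ∑ i ∈ range p, (n : ℤ) ^ i := by
    rw [← ZMod.intCast_zmod_eq_zero_iff_dvd]
    have hn1 : (n : ZMod p) = 1 := by
      have := (ZMod.natCast_eq_natCast_iff n 1 p).mpr hnp
      rwa [Nat.cast_one] at this
    push_cast
    simp only [hn1, one_pow, sum_const, card_range, nsmul_eq_mul, mul_one, ZMod.natCast_self]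
  have hdvd : ((p * m : ℕ) : ℤ) ∣ (n : ℤ) ^ p - 1 := by
    rw [← geom_sum_mul, Nat.cast_mul]
    exact mul_dvd_mul hdvd2 hdvd1
  -- hence `x^p = 1` and `χ(x)^p = 1`
  have hxp : (x : ZMod (p * m)) ^ p = 1 := by
    rw [hxn]
    have h0 : (((n : ℤ) ^ p - 1 : ℤ) : ZMod (p * m)) = 0 :=
      (ZMod.intCast_zmod_eq_zero_iff_dvd _ _).mpr hdvd
    push_cast at h0
    exact sub_eq_zero.mp h0
  have hχp : χ ((x : ZMod (p * m)) ^ p) = 1 := by rw [hxp, map_one]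
  rw [map_pow, hxm1, hpodd.neg_one_pow] at hχp
  norm_num at hχp

/-! ### Odd characters of odd modulus: `q ≡ 3 (mod 4)` -/

/-- For `q > 1`, `χ(−1) = (−1/q)` for the primitive quadratic character mod an odd squarefree `q`
(from `apply_natCast_eq_jacobiSym` at `n = q − 1`). [folklore] -/
theorem apply_neg_one_eq_jacobiSym {q : ℕ} [NeZero q] (hodd : Odd q) (hsq : Squarefree q)
    (h1 : 1 < q) (χ : DirichletCharacter ℂ q) (hprim : χ.IsPrimitive) (hquad : χ.IsQuadratic) :
    χ (-1) = jacobiSym (-1) q := by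
  have hneg : ((q - 1 : ℕ) : ZMod q) = -1 := by
    rw [Nat.cast_sub h1.le, ZMod.natCast_self, zero_sub, Nat.cast_one]
  have hval := apply_natCast_eq_jacobiSym hodd hsq χ hprim hquad (q - 1)
  rw [hneg] at hval
  have hJ : jacobiSym ((q - 1 : ℕ) : ℤ) q = jacobiSym (-1) q := by
    have : ((q - 1 : ℕ) : ℤ) = -1 + q := by push_cast [Nat.cast_sub h1.le]; ring
    rw [this, jacobiSym.mod_left, Int.add_emod_right, ← jacobiSym.mod_left]
  rw [hval, hJ]

/-- **An odd primitive quadratic character of odd modulus `q` has `q ≡ 3 (mod 4)`**: `q` is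
squarefree (`squarefree_of_isPrimitive_of_isQuadratic`), so `χ = (·/q)` and
`−1 = χ(−1) = (−1/q) = χ₄(q)`. [cite: MontgomeryVaughan2007, Theorem 9.13] -/
theorem mod_four_eq_three_of_odd {q : ℕ} [NeZero q] (hodd : Odd q) {χ : DirichletCharacter ℂ q}
    (hprim : χ.IsPrimitive) (hquad : χ.IsQuadratic) (hχ : χ.Odd) : q % 4 = 3 := by
  have hsq := squarefree_of_isPrimitive_of_isQuadratic hodd hprim hquad
  have hodd' : χ (-1) = -1 := hχ
  -- `q ≠ 1`: modulo `1`, `-1 = 1` and `χ(1) = 1 ≠ -1`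
  have h1 : 1 < q := by
    rcases Nat.lt_or_ge 1 q with h | h
    · exact h
    · exfalso
      have hq1 : q = 1 := le_antisymm h NeZero.one_le
      subst hq1
      have : (-1 : ZMod 1) = 1 := Subsingleton.elim _ _
      rw [this, map_one] at hodd'
      norm_num at hodd'
  have hval := apply_neg_one_eq_jacobiSym hodd hsq h1 χ hprim hquad
  rw [hodd', jacobiSym.at_neg_one hodd, ZMod.χ₄_nat_eq_if_mod_four] at hval
  have hq2 : q % 2 = 1 := Nat.odd_iff.mp hodd
  rw [if_neg (by omega)] at hval
  by_contra h3
  have h1' : q % 4 = 1 := by omega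
  rw [if_pos h1'] at hval
  norm_num at hval

/-- **An even primitive quadratic character of odd modulus `q > 1` has `q ≡ 1 (mod 4)`**
(`1 = χ(−1) = (−1/q) = χ₄(q)`). [cite: MontgomeryVaughan2007, Theorem 9.13] -/
theorem mod_four_eq_one_of_even {q : ℕ} [NeZero q] (hodd : Odd q) (h1 : 1 < q)
    {χ : DirichletCharacter ℂ q} (hprim : χ.IsPrimitive) (hquad : χ.IsQuadratic) (hχ : χ.Even) :
    q % 4 = 1 := by
  have hsq := squarefree_of_isPrimitive_of_isQuadratic hodd hprim hquad
  have heven' : χ (-1) = 1 := hχ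
  have hval := apply_neg_one_eq_jacobiSym hodd hsq h1 χ hprim hquad
  rw [heven', jacobiSym.at_neg_one hodd, ZMod.χ₄_nat_eq_if_mod_four] at hval
  have hq2 : q % 2 = 1 := Nat.odd_iff.mp hodd
  rw [if_neg (by omega)] at hval
  by_contra h3
  rw [if_neg h3] at hval
  norm_num at hval

/-- **The modulus of an odd primitive quadratic character is minus a discriminant**:
`−q ≡ 0` or `1 (mod 4)` (`4 ∣ q` if `q` is even, `q ≡ 3 (mod 4)` if `q` is odd). In particular the
reduced forms of discriminant `−q` include the principal form and `h(−q) ≥ 1`.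
[cite: MontgomeryVaughan2007, Theorem 9.13] -/
theorem neg_emod_four_of_odd {q : ℕ} [NeZero q] {χ : DirichletCharacter ℂ q}
    (hprim : χ.IsPrimitive) (hquad : χ.IsQuadratic) (hχ : χ.Odd) :
    (-(q : ℤ)) % 4 = 0 ∨ (-(q : ℤ)) % 4 = 1 := by
  rcases Nat.even_or_odd q with he | ho
  · left
    obtain ⟨k, hk⟩ := four_dvd_of_isPrimitive_of_even he hprim
    subst hk
    push_cast
    omega
  · right
    have h3 := mod_four_eq_three_of_odd ho hprim hquad hχ
    omega

end Literature.NumberTheory.LFunctions.PrimitiveQuadratic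

end
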